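import Summits.BirchSwinnertonDyer.BirchSwinnertonDyer.Theorems.BiquadraticEisensteinDescentManinDatumSupercuspidalCMInertSevenDivisionCurrency
import Summits.BirchSwinnertonDyer.BirchSwinnertonDyer.Theorems.BiquadraticEisensteinDescentManinDatumSupercuspidalCMInertThetaValueAssembly
import HarnessLib

set_option linter.dupNamespace false -- `Summit.BirchSwinnertonDyer.BirchSwinnertonDyer.Theorems.…` (summit = sub, D-0017)
set_option autoImplicit false

/-!
# Crux `ManinDatumSupercuspidalCMInert` (stmt-BirchSwinnertonDyer-20111, BED r605), stub `stub_S7` — EXPANSION + PACKAGING: the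
# algebraized `7`-torsion sum `Y(w)·Σ_b Φ(b)/(X(w) − X(t_b))` is `7^{(4−k)/4}`-divisible in the `7 ∤ s` currency as soon as the
# RESOLVENTS `R_n = Σ_b Φ(b)·X(t_b)⁻ⁿ` satisfy `v(R_n)⁴ ≤ v(7)^{4−k}` at every valuation above `7`
# (width seat `bsd-wall-cm-bed-w2` g10; theorems only; `--supports 20111`, helper)

Route `BiquadraticEisensteinDescent` (cell `pub/bsd-wall`). The X-FORMAL step of the design note `Cruxes/…/MODEL-ASSEMBLY-LANES-w2g10.md`:
for a prime-to-`7` torsion point `w` (`w ∉ Λ`, `M′w ∈ Λ`, `(M′,7) = 1`) and the `7`-division points `t_b` (`b ∈ (ℤ/7)² ∖ 0`), in the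
normalised coordinates `X = ℘/ϖ₀²`, `Y = ℘′/(2ϖ₀³)` of `y² = x³ − x`, with `π_b := X(t_b)⁻¹` (`v(π_b)²⁴ = v 7`, bed-w4 g10 p636843):
  `1/(X(w) − X(t_b)) = −Σ_{n<24} X(w)ⁿ·π_b^{n+1} + (X(w)π_b)²⁴/(X(w) − X(t_b))`,
so `Σ_b Φ(b)/(X(w) − X(t_b)) = −Σ_{n<24} X(w)ⁿ·R_{n+1} + Σ_b Φ(b)X(w)²⁴π_b²⁴/(X(w) − X(t_b))` with `R_n := Σ_b Φ(b)π_bⁿ`, and every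
tail term has valuation `≤ v 7`. Hence:

* `val_sum_pow_le` — ultrametric bookkeeping: `v(f i)ⁿ ≤ B` for all `i` gives `v(Σ f i)ⁿ ≤ B`.
* ★ `val_coreSum_pow_four_le` — for EVERY valuation `v` of `ℂ` with `v 7 < 1`: if `v(R_n)⁴ ≤ v(7)^{4−k}` for all `n ≥ 1` (the RESOLVENT
  BOUND, = the output of bed-w4 g10's `resolvent_valuation_le` with `e = 48`, `j = 48 − 12k`, `ϖ = x/y(Q₁)`, `v ϖ⁴⁸ = v 7`), then
  `v(Y(w)·Σ_b Φ(b)/(X(w) − X(t_b)))⁴ ≤ v(7)^{4−k}` (`X(w)`, `Y(w)` are `v`-integral, p637401 `val_normalized_le_one_of_torsion`).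
* ★ `coreSum_integral_of_resolventBound` — with `Φ` algebraic-integer valued and `1 ≤ k ≤ 3`: the resolvent bound at all `v ∣ 7` gives
  `∃ s, 7 ∤ s, s·(Y(w)·Σ_b Φ(b)/(X(w) − X(t_b)))/7^{(4−k)/4} ∈ ℤ̄` — the TERMWISE form of Core₇/T₇ (`…TorsionCoreBezoutFree`,
  `…CMInertStubS7OfTorsionIntegral`) once the torsion sum is algebraized (bed-w3 g9, claim 13:39Z: `T_k(w)/ϖ₀ = Y(w)·Σ_b Φ(b)/(X(w) − X(t_b))`
  for `w ∉ Λ`). Packaging: `…SevenDivisionCurrency.exists_isIntegral_pow_mul_div_sub` (`7ᵃN/(X(w) − X(t_b)) ∈ ℤ̄`) and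
  `…SevenDivisionCurrency.exists_not_dvd_mul_isIntegral_of_forall_valuation`.

The weight `Φ : (ℤ/7)² → ℂ` (with `Φ 0 = 0`) and the labelling `t : (ℤ/7)² → ℂ` of the `7`-division points are ABSTRACT, so either orientation
(`t_b = ±conj(b)/7`, `Φ = conj((·/7)₄)^k` or `(·/7)₄^k`) plugs in. HONEST FRAMING: the resolvent bound is NOT proved here (it is step (d) of memo
PLAIN-ODD-57 / the design note: Galois structure of `ℚ(i)(E₀[7])`); nothing here proves Core₇, the stub, the crux, Manin's conjecture or BSD.
No definition, no named fact, no `sorry`; axioms standard.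
-/

noncomputable section

open scoped Classical
open Complex PeriodPair
open Literature.NumberTheory.EllipticCurves Literature.NumberTheory.EllipticCurves.GaussianLattice

namespace Summit.BirchSwinnertonDyer.BirchSwinnertonDyer.Theorems.BiquadraticEisensteinDescentManinDatumSupercuspidalCMInertTorsionCoreOfResolventBound

open Summit.BirchSwinnertonDyer.BirchSwinnertonDyer.Theorems.BiquadraticEisensteinDescentManinDatumSupercuspidalCMInertFormalChord
  (val_le_one_of_isIntegral val_normalized_le_one_of_torsion)
open Summit.BirchSwinnertonDyer.BirchSwinnertonDyer.Theorems.BiquadraticEisensteinDescentManinDatumSupercuspidalCMInertSevenDivisionEisenstein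
  (val_weierstrassP_seven_div)
open Summit.BirchSwinnertonDyer.BirchSwinnertonDyer.Theorems.BiquadraticEisensteinDescentManinDatumSupercuspidalCMInertSevenDivisionCurrency
  (exists_isIntegral_pow_mul_div_sub exists_not_dvd_mul_isIntegral_of_forall_valuation)
open Summit.BirchSwinnertonDyer.BirchSwinnertonDyer.Theorems.InertBadSignedBranchesInertBadAtThreeQuarticTorsionCoordinates
  (torsion_coord_isIntegral)
open Summit.BirchSwinnertonDyer.BirchSwinnertonDyer.Theorems.BiquadraticEisensteinDescentManinDatumSupercuspidalCMInertThetaValueAssembly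
  (cpow_quarter_mul_cpow_quarter_of_le)

/-! ## §1 Ultrametric bookkeeping -/

section Valued

variable {Γ₀ : Type*} [LinearOrderedCommGroupWithZero Γ₀] (v : Valuation ℂ Γ₀)

/-- **Ultrametric bookkeeping with powers**: if `v(f i)ⁿ ≤ B` for every `i ∈ s` (`n ≠ 0`), then `v(Σ_{i ∈ s} f i)ⁿ ≤ B`. [folklore] -/
theorem val_sum_pow_le {ι : Type*} (s : Finset ι) (f : ι → ℂ) {n : ℕ} (hn : n ≠ 0) {B : Γ₀}
    (h : ∀ i ∈ s, v (f i) ^ n ≤ B) : v (∑ i ∈ s, f i) ^ n ≤ B := by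
  rcases s.eq_empty_or_nonempty with hs | hs
  · rw [hs, Finset.sum_empty, Valuation.map_zero, zero_pow hn]; exact zero_le
  · obtain ⟨j, hj, hmax⟩ := Finset.exists_max_image s (fun i ↦ v (f i)) hs
    have hle : v (∑ i ∈ s, f i) ≤ v (f j) := Valuation.map_sum_le v fun i hi ↦ hmax i hi
    exact le_trans (pow_le_pow_left₀ zero_le hle n) (h j hj)

/-- `v(a + b)ⁿ ≤ B` from `v(a)ⁿ ≤ B` and `v(b)ⁿ ≤ B`. [folklore] -/
theorem val_add_pow_le {a b : ℂ} {n : ℕ} {B : Γ₀} (ha : v a ^ n ≤ B) (hb : v b ^ n ≤ B) : v (a + b) ^ n ≤ B := by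
  rcases le_total (v a) (v b) with h | h
  · exact le_trans (pow_le_pow_left₀ zero_le (le_trans (Valuation.map_add v a b) (max_le h le_rfl)) n) hb
  · exact le_trans (pow_le_pow_left₀ zero_le (le_trans (Valuation.map_add v a b) (max_le le_rfl h)) n) ha

end Valued

/-! ## §2 The valuation bound from the resolvent bound -/

/-- Geometric expansion: for `x ≠ u` and `π = u⁻¹` (`u ≠ 0`),
`1/(x − u) = −Σ_{n<N} xⁿ π^{n+1} + (xπ)^N/(x − u)`. [folklore] -/
theorem inv_sub_eq_geom {x u : ℂ} (hu : u ≠ 0) (hxu : x ≠ u) (N : ℕ) :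
    1 / (x - u) = -(∑ n ∈ Finset.range N, x ^ n * u⁻¹ ^ (n + 1)) + (x * u⁻¹) ^ N / (x - u) := by
  have hsub : x - u ≠ 0 := sub_ne_zero.mpr hxu
  set y : ℂ := u⁻¹ with hy
  have huy : u * y = 1 := mul_inv_cancel₀ hu
  have key : (x - u) * (∑ n ∈ Finset.range N, x ^ n * y ^ (n + 1)) = (x * y) ^ N - 1 := by
    induction N with
    | zero => simp
    | succ N ih =>
      rw [Finset.sum_range_succ, mul_add, ih]
      linear_combination (-(x * y) ^ N) * huy
  have hgsum : ∑ n ∈ Finset.range N, x ^ n * y ^ (n + 1) = ((x * y) ^ N - 1) / (x - u) := by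
    rw [eq_div_iff hsub, mul_comm]; exact key
  rw [hgsum]
  field_simp
  ring

/-- ★ **The valuation bound from the resolvent bound.** `w` a prime-to-`7` torsion point (`w ∉ Λ`, `M′w ∈ Λ`, `(M′, 7) = 1`), `t_b`
(`b ≠ 0`) `7`-division points, `Φ 0 = 0`, `v(Φ b) ≤ 1`; `X = ℘/ϖ₀²`, `Y = ℘′/(2ϖ₀³)`. For a valuation `v` of `ℂ` with `v 7 < 1`: if
`v(Σ_b Φ(b)·X(t_b)⁻ⁿ)⁴ ≤ v(7)^{4−k}` for all `n ≥ 1`, then `v(Y(w)·Σ_b Φ(b)/(X(w) − X(t_b)))⁴ ≤ v(7)^{4−k}`. [cite: Serre1979, Ch. IV §2 Prop. 7] -/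
theorem val_coreSum_pow_four_le {Γ₀ : Type*} [LinearOrderedCommGroupWithZero Γ₀] (v : Valuation ℂ Γ₀) (h7 : v 7 < 1)
    {k : ℕ} (hk : k ≤ 4) (Φ : ZMod 7 × ZMod 7 → ℂ) (hΦ0 : Φ 0 = 0) (hΦv : ∀ b, v (Φ b) ≤ 1)
    (t : ZMod 7 × ZMod 7 → ℂ)
    (ht : ∀ b, b ≠ 0 → t b ∉ (ofUpperHalfPlane UpperHalfPlane.I).lattice ∧ (7 : ℂ) * t b ∈ (ofUpperHalfPlane UpperHalfPlane.I).lattice)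
    {w : ℂ} {M' : ℕ} (hw : w ∉ (ofUpperHalfPlane UpperHalfPlane.I).lattice)
    (hMw : ((M' : ℂ) * w) ∈ (ofUpperHalfPlane UpperHalfPlane.I).lattice) (hM7 : Nat.Coprime M' 7)
    (hRES : ∀ n : ℕ, 1 ≤ n →
      v (∑ b : ZMod 7 × ZMod 7, Φ b *
        (℘[ofUpperHalfPlane UpperHalfPlane.I] (t b) / ((Real.Gamma (1 / 4) ^ 2 / (2 * Real.sqrt (2 * Real.pi)) : ℝ) : ℂ) ^ 2)⁻¹ ^ n) ^ 4
        ≤ v 7 ^ (4 - k)) :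
    v (℘'[ofUpperHalfPlane UpperHalfPlane.I] w / (2 * ((Real.Gamma (1 / 4) ^ 2 / (2 * Real.sqrt (2 * Real.pi)) : ℝ) : ℂ) ^ 3) *
      ∑ b : ZMod 7 × ZMod 7, Φ b /
        (℘[ofUpperHalfPlane UpperHalfPlane.I] w / ((Real.Gamma (1 / 4) ^ 2 / (2 * Real.sqrt (2 * Real.pi)) : ℝ) : ℂ) ^ 2 -
          ℘[ofUpperHalfPlane UpperHalfPlane.I] (t b) / ((Real.Gamma (1 / 4) ^ 2 / (2 * Real.sqrt (2 * Real.pi)) : ℝ) : ℂ) ^ 2)) ^ 4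
      ≤ v 7 ^ (4 - k) := by
  -- facts about `w` and the `t_b` first, then name the coordinates
  obtain ⟨hXw, hYw⟩ := val_normalized_le_one_of_torsion v h7 hw hMw hM7
  have hTb := fun b (hb : b ≠ 0) ↦ val_weierstrassP_seven_div v h7 (ht b hb).1 (ht b hb).2
  set ϖ : ℂ := ((Real.Gamma (1 / 4) ^ 2 / (2 * Real.sqrt (2 * Real.pi)) : ℝ) : ℂ) with hϖ
  set Xw : ℂ := ℘[ofUpperHalfPlane UpperHalfPlane.I] w / ϖ ^ 2 with hXwdef
  set Yw : ℂ := ℘'[ofUpperHalfPlane UpperHalfPlane.I] w / (2 * ϖ ^ 3) with hYwdef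
  set Xt : ZMod 7 × ZMod 7 → ℂ := fun b ↦ ℘[ofUpperHalfPlane UpperHalfPlane.I] (t b) / ϖ ^ 2 with hXtdef
  have h71 : v 7 ≤ 1 := h7.le
  have hB4 : v 7 ^ 4 ≤ v 7 ^ (4 - k) := pow_le_pow_right_of_le_one' h71 (by omega)
  -- per non-zero class: `X_b ≠ 0`, `v(π_b)²⁴ = v 7`, `v π_b < 1 < v X_b`, `X_w ≠ X_b`, `v (X_w − X_b) = v X_b`
  have hcls : ∀ b, b ≠ 0 → Xt b ≠ 0 ∧ v (Xt b)⁻¹ ^ 24 = v 7 ∧ v (Xt b)⁻¹ < 1 ∧ Xw ≠ Xt b ∧ v (Xw - Xt b) = v (Xt b) := by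
    intro b hb
    obtain ⟨hX0, -, hvX, -⟩ := hTb b hb
    have hπ1 : v (Xt b)⁻¹ < 1 := by
      by_contra hge
      push Not at hge
      have : (1 : Γ₀) ≤ v (Xt b)⁻¹ ^ 24 := one_le_pow₀ hge
      rw [hvX] at this
      exact absurd h7 (not_lt.mpr this)
    have hvXpos : 0 < v (Xt b) := lt_of_le_of_ne zero_le (Ne.symm ((Valuation.ne_zero_iff v).mpr hX0))
    have hXbig : 1 < v (Xt b) := by
      have h := hπ1
      rw [map_inv₀] at h
      exact (inv_lt_one₀ hvXpos).mp h
    have hne : Xw ≠ Xt b := by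
      intro h
      rw [h] at hXw
      exact absurd hXbig (not_lt.mpr hXw)
    have hvsub : v (Xw - Xt b) = v (Xt b) := by
      rw [sub_eq_add_neg, add_comm, Valuation.map_add_eq_of_lt_left]
      · rw [Valuation.map_neg]
      · rw [Valuation.map_neg]; exact lt_of_le_of_lt hXw hXbig
    exact ⟨hX0, hvX, hπ1, hne, hvsub⟩
  -- the termwise expansion (valid for every class: both sides vanish at `b = 0`)
  have hexp : ∀ b, Φ b / (Xw - Xt b) =
      -(∑ n ∈ Finset.range 24, Φ b * (Xw ^ n * (Xt b)⁻¹ ^ (n + 1))) +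
        Φ b * ((Xw * (Xt b)⁻¹) ^ 24 / (Xw - Xt b)) := by
    intro b
    by_cases hb : b = 0
    · rw [hb, hΦ0]; simp
    · obtain ⟨hX0, -, -, hne, -⟩ := hcls b hb
      have h := inv_sub_eq_geom hX0 hne 24
      rw [div_eq_mul_one_div (Φ b), h, ← Finset.mul_sum]
      ring
  have hsum : ∑ b, Φ b / (Xw - Xt b) =
      -(∑ n ∈ Finset.range 24, Xw ^ n * ∑ b, Φ b * (Xt b)⁻¹ ^ (n + 1)) +
        ∑ b, Φ b * ((Xw * (Xt b)⁻¹) ^ 24 / (Xw - Xt b)) := by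
    rw [Finset.sum_congr rfl (fun b _ ↦ hexp b), Finset.sum_add_distrib, Finset.sum_neg_distrib, Finset.sum_comm]
    congr 2
    refine Finset.sum_congr rfl fun n _ ↦ ?_
    rw [Finset.mul_sum]
    refine Finset.sum_congr rfl fun b _ ↦ ?_
    ring
  -- bounds
  have hmain : ∀ n ∈ Finset.range 24, v (Xw ^ n * ∑ b, Φ b * (Xt b)⁻¹ ^ (n + 1)) ^ 4 ≤ v 7 ^ (4 - k) := by
    intro n _
    rw [Valuation.map_mul, mul_pow, Valuation.map_pow]
    have h1 : (v Xw ^ n) ^ 4 ≤ 1 := pow_le_one₀ zero_le (pow_le_one₀ zero_le hXw)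
    exact le_trans (mul_le_of_le_one_left zero_le h1) (hRES (n + 1) (by omega))
  have htail : ∀ b ∈ (Finset.univ : Finset (ZMod 7 × ZMod 7)),
      v (Φ b * ((Xw * (Xt b)⁻¹) ^ 24 / (Xw - Xt b))) ^ 4 ≤ v 7 ^ (4 - k) := by
    intro b _
    by_cases hb : b = 0
    · rw [hb, hΦ0, zero_mul, Valuation.map_zero, zero_pow four_ne_zero]; exact zero_le
    · obtain ⟨hX0, hvX, hπ1, hne, hvsub⟩ := hcls b hb
      have hvXb0 : v (Xt b) ≠ 0 := (Valuation.ne_zero_iff v).mpr hX0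
      -- `v(term) = v Φ · v Xw ^ 24 · v 7 · v π ≤ v 7`
      have hterm : v (Φ b * ((Xw * (Xt b)⁻¹) ^ 24 / (Xw - Xt b))) ≤ v 7 := by
        rw [Valuation.map_mul, map_div₀, Valuation.map_pow, Valuation.map_mul, mul_pow, hvsub,
          show v (Xt b)⁻¹ ^ 24 = v 7 from hvX]
        have hq : v Xw ^ 24 * v 7 / v (Xt b) = v Xw ^ 24 * v 7 * v (Xt b)⁻¹ := by
          rw [map_inv₀, div_eq_mul_inv]
        rw [hq]
        have h1 : v (Φ b) * (v Xw ^ 24 * v 7 * v (Xt b)⁻¹) ≤ 1 * (1 * v 7 * 1) := by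
          refine mul_le_mul' (hΦv b) (mul_le_mul' (mul_le_mul' (pow_le_one₀ zero_le hXw) le_rfl) hπ1.le)
        simpa using h1
      exact le_trans (pow_le_pow_left₀ zero_le hterm 4) hB4
  have hS : v (∑ b, Φ b / (Xw - Xt b)) ^ 4 ≤ v 7 ^ (4 - k) := by
    rw [hsum]
    refine val_add_pow_le v ?_ (val_sum_pow_le v _ _ four_ne_zero htail)
    rw [Valuation.map_neg]
    exact val_sum_pow_le v _ _ four_ne_zero hmain
  -- multiply by the integral `Y(w)`
  rw [Valuation.map_mul, mul_pow]
  exact le_trans (mul_le_of_le_one_left zero_le (pow_le_one₀ zero_le hYw)) hS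

/-! ## §3 Packaging in the `7 ∤ s` currency -/

/-- ★ **The termwise core statement from the resolvent bound.** `w ∉ Λ`, `M′w ∈ Λ`, `(M′, 7) = 1`; `Φ : (ℤ/7)² → ℂ` with `Φ 0 = 0` and
algebraic-integer values; `t_b` (`b ≠ 0`) `7`-division points; `1 ≤ k ≤ 3`. If for EVERY valuation `v` of `ℂ` with `v 7 < 1` and every
`n ≥ 1` the resolvent bound `v(Σ_b Φ(b)·X(t_b)⁻ⁿ)⁴ ≤ v(7)^{4−k}` holds, then
`∃ s ∈ ℕ, 7 ∤ s, s·(Y(w)·Σ_b Φ(b)/(X(w) − X(t_b)))/7^{(4−k)/4} ∈ ℤ̄`. [cite: Serre1979, Ch. IV §2 Prop. 7] [cite: ZariskiSamuel1960, Vol. II, Ch. VI §4, Thm. 6] -/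
theorem coreSum_integral_of_resolventBound {k : ℕ} (hk1 : 1 ≤ k) (hk3 : k ≤ 3)
    (Φ : ZMod 7 × ZMod 7 → ℂ) (hΦ0 : Φ 0 = 0) (hΦint : ∀ b, IsIntegral ℤ (Φ b))
    (t : ZMod 7 × ZMod 7 → ℂ)
    (ht : ∀ b, b ≠ 0 → t b ∉ (ofUpperHalfPlane UpperHalfPlane.I).lattice ∧ (7 : ℂ) * t b ∈ (ofUpperHalfPlane UpperHalfPlane.I).lattice)
    {w : ℂ} {M' : ℕ} (hw : w ∉ (ofUpperHalfPlane UpperHalfPlane.I).lattice)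
    (hMw : ((M' : ℂ) * w) ∈ (ofUpperHalfPlane UpperHalfPlane.I).lattice) (hM7 : Nat.Coprime M' 7)
    (hRES : ∀ n : ℕ, 1 ≤ n → ∀ (Γ₀ : Type) [LinearOrderedCommGroupWithZero Γ₀] (v : Valuation ℂ Γ₀), v 7 < 1 →
      v (∑ b : ZMod 7 × ZMod 7, Φ b *
        (℘[ofUpperHalfPlane UpperHalfPlane.I] (t b) / ((Real.Gamma (1 / 4) ^ 2 / (2 * Real.sqrt (2 * Real.pi)) : ℝ) : ℂ) ^ 2)⁻¹ ^ n) ^ 4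
        ≤ v 7 ^ (4 - k)) :
    ∃ s : ℕ, ¬ 7 ∣ s ∧ IsIntegral ℤ ((s : ℂ) *
      ((℘'[ofUpperHalfPlane UpperHalfPlane.I] w / (2 * ((Real.Gamma (1 / 4) ^ 2 / (2 * Real.sqrt (2 * Real.pi)) : ℝ) : ℂ) ^ 3) *
        ∑ b : ZMod 7 × ZMod 7, Φ b /
          (℘[ofUpperHalfPlane UpperHalfPlane.I] w / ((Real.Gamma (1 / 4) ^ 2 / (2 * Real.sqrt (2 * Real.pi)) : ℝ) : ℂ) ^ 2 -
            ℘[ofUpperHalfPlane UpperHalfPlane.I] (t b) / ((Real.Gamma (1 / 4) ^ 2 / (2 * Real.sqrt (2 * Real.pi)) : ℝ) : ℂ) ^ 2)) /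
        (7 : ℂ) ^ (((4 - k : ℕ) : ℂ) / 4))) := by
  have hM0 : M' ≠ 0 := by rintro rfl; exact absurd hM7 (by decide)
  -- algebraic-integrality facts first, then name the coordinates
  obtain ⟨-, hYint⟩ := torsion_coord_isIntegral hw hMw hM0
  have hdiv := fun b (hb : b ≠ 0) ↦ exists_isIntegral_pow_mul_div_sub hw hMw hM7 (ht b hb).1 (ht b hb).2
  have hvalw := fun (Γ₀ : Type) [LinearOrderedCommGroupWithZero Γ₀] (v : Valuation ℂ Γ₀) (hv : v 7 < 1) ↦
    val_coreSum_pow_four_le v hv (show k ≤ 4 by omega) Φ hΦ0 (fun b ↦ val_le_one_of_isIntegral v (hΦint b)) t ht hw hMw hM7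
      (fun n hn ↦ hRES n hn Γ₀ v hv)
  set ϖ : ℂ := ((Real.Gamma (1 / 4) ^ 2 / (2 * Real.sqrt (2 * Real.pi)) : ℝ) : ℂ) with hϖ
  set Xw : ℂ := ℘[ofUpperHalfPlane UpperHalfPlane.I] w / ϖ ^ 2 with hXwdef
  set Yw : ℂ := ℘'[ofUpperHalfPlane UpperHalfPlane.I] w / (2 * ϖ ^ 3) with hYwdef
  set Xt : ZMod 7 × ZMod 7 → ℂ := fun b ↦ ℘[ofUpperHalfPlane UpperHalfPlane.I] (t b) / ϖ ^ 2 with hXtdef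
  set S : ℂ := ∑ b : ZMod 7 × ZMod 7, Φ b / (Xw - Xt b) with hSdef
  set ρ : ℂ := (7 : ℂ) ^ (((4 - k : ℕ) : ℂ) / 4) with hρ
  set τ : ℂ := (7 : ℂ) ^ ((k : ℂ) / 4) with hτ
  have hτρ : τ * ρ = 7 := cpow_quarter_mul_cpow_quarter_of_le (by norm_num) (by omega)
  have hρ0 : ρ ≠ 0 := by
    intro h; have := (Complex.cpow_eq_zero_iff _ _).mp h; norm_num at this
  have hρ4 : ρ ^ 4 = 7 ^ (4 - k) := by
    rw [hρ, ← Complex.cpow_nat_mul, show ((4 : ℕ) : ℂ) * ((((4 - k : ℕ)) : ℂ) / 4) = ((4 - k : ℕ) : ℂ) by push_cast; ring,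
      Complex.cpow_natCast]
  have hτint : IsIntegral ℤ τ := by
    refine IsIntegral.of_pow (n := 4) (by norm_num) ?_
    rw [hτ, ← Complex.cpow_nat_mul, show ((4 : ℕ) : ℂ) * ((k : ℂ) / 4) = ((k : ℕ) : ℂ) by push_cast; ring, Complex.cpow_natCast]
    simpa using (isIntegral_algebraMap (R := ℤ) (A := ℂ) (x := (7 : ℤ))).pow k
  -- (α) `7ᵃ · N · (Yw · S)` is an algebraic integer for suitable `a`, `N ⟂ 7`
  have hterm : ∀ b : ZMod 7 × ZMod 7, ∃ a N : ℕ, ¬ 7 ∣ N ∧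
      IsIntegral ℤ ((7 : ℂ) ^ a * (N : ℂ) * ((M' : ℂ) ^ 3 * Yw * (Φ b / (Xw - Xt b)))) := by
    intro b
    by_cases hb : b = 0
    · refine ⟨0, 1, by norm_num, ?_⟩
      rw [hb, hΦ0, zero_div, mul_zero, mul_zero]; exact isIntegral_zero
    · obtain ⟨a, N, hN, hint⟩ := hdiv b hb
      refine ⟨a, N, hN, ?_⟩
      have e : (7 : ℂ) ^ a * (N : ℂ) * ((M' : ℂ) ^ 3 * Yw * (Φ b / (Xw - Xt b))) =
          ((M' : ℂ) ^ 3 * Yw) * Φ b * ((7 : ℂ) ^ a * (N : ℂ) / (Xw - Xt b)) := by ring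
      rw [e]
      exact (hYint.mul (hΦint b)).mul hint
  choose a N hN hint using hterm
  have hprod_int : IsIntegral ℤ ((7 : ℂ) ^ (∑ b, a b) * ((∏ b, N b : ℕ) : ℂ) * ((M' : ℂ) ^ 3 * Yw * S)) := by
    have e : (7 : ℂ) ^ (∑ b, a b) * ((∏ b, N b : ℕ) : ℂ) * ((M' : ℂ) ^ 3 * Yw * S) =
        ∑ b, (∏ b' ∈ Finset.univ.erase b, (7 : ℂ) ^ a b' * (N b' : ℂ)) *
          ((7 : ℂ) ^ a b * (N b : ℂ) * ((M' : ℂ) ^ 3 * Yw * (Φ b / (Xw - Xt b)))) := by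
      rw [hSdef, Finset.mul_sum, Finset.mul_sum]
      refine Finset.sum_congr rfl fun b _ ↦ ?_
      have hsplit : (7 : ℂ) ^ (∑ b, a b) * ((∏ b, N b : ℕ) : ℂ) =
          (∏ b' ∈ Finset.univ.erase b, (7 : ℂ) ^ a b' * (N b' : ℂ)) * ((7 : ℂ) ^ a b * (N b : ℂ)) := by
        rw [← Finset.prod_pow_eq_pow_sum, Nat.cast_prod, ← Finset.prod_mul_distrib,
          ← Finset.prod_erase_mul Finset.univ _ (Finset.mem_univ b)]
      rw [hsplit]; ring
    rw [e]
    refine IsIntegral.sum _ fun b _ ↦ IsIntegral.mul ?_ (hint b)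
    refine IsIntegral.prod _ fun b' _ ↦ ?_
    have h7 : IsIntegral ℤ ((7 : ℂ) ^ a b') := by
      simpa using (isIntegral_algebraMap (R := ℤ) (A := ℂ) (x := (7 : ℤ))).pow (a b')
    have hNb : IsIntegral ℤ (N b' : ℂ) := by simpa using isIntegral_algebraMap (R := ℤ) (A := ℂ) (x := (N b' : ℤ))
    exact h7.mul hNb
  have hNprod : ¬ 7 ∣ (∏ b, N b) * M' ^ 3 := by
    intro h
    rcases (Nat.Prime.dvd_mul (by norm_num : Nat.Prime 7)).mp h with h | h
    · rw [Prime.dvd_finsetProd_iff (by norm_num : Nat.Prime 7).prime] at h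
      obtain ⟨b, -, hb⟩ := h
      exact hN b hb
    · have h' : 7 ∣ M' := Nat.Prime.dvd_of_dvd_pow (by norm_num) h
      have := Nat.Coprime.eq_one_of_dvd (Nat.Coprime.symm hM7) h'
      omega
  -- the target element
  set z₀ : ℂ := (Yw * S) / ρ with hz₀
  have hint7 : IsIntegral ℤ ((7 : ℂ) ^ (∑ b, a b + 1) * ((((∏ b, N b) * M' ^ 3 : ℕ) : ℂ) * z₀)) := by
    have e : (7 : ℂ) ^ (∑ b, a b + 1) * ((((∏ b, N b) * M' ^ 3 : ℕ) : ℂ) * z₀) =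
        ((7 : ℂ) ^ (∑ b, a b) * ((∏ b, N b : ℕ) : ℂ) * ((M' : ℂ) ^ 3 * Yw * S)) * τ := by
      rw [hz₀, pow_succ]
      have h7 : (7 : ℂ) = τ * ρ := hτρ.symm
      push_cast
      field_simp
      rw [h7]; ring
    rw [e]
    exact hprod_int.mul hτint
  -- (β) `v z₀ ≤ 1` at every `v ∣ 7`
  have hval : ∀ (Γ₀ : Type) [LinearOrderedCommGroupWithZero Γ₀] (v : Valuation ℂ Γ₀), v 7 < 1 → v z₀ ≤ 1 := by
    intro Γ₀ _ v hv
    have h4 : v (Yw * S) ^ 4 ≤ v 7 ^ (4 - k) := hvalw Γ₀ v hv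
    have hρv : v ρ ^ 4 = v 7 ^ (4 - k) := by rw [← Valuation.map_pow, hρ4, Valuation.map_pow]
    have hρv0 : 0 < v ρ := lt_of_le_of_ne zero_le (Ne.symm ((Valuation.ne_zero_iff v).mpr hρ0))
    rw [← hρv] at h4
    have hle : v (Yw * S) ≤ v ρ := le_of_pow_le_pow_left₀ four_ne_zero zero_le h4
    rw [hz₀, map_div₀]
    exact div_le_one_of_le₀ hle zero_le
  obtain ⟨s, hs, hsint⟩ := exists_not_dvd_mul_isIntegral_of_forall_valuation (p := 7) (by norm_num) hNprod hint7 hval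
  exact ⟨s, hs, by rw [hz₀] at hsint; exact hsint⟩

end Summit.BirchSwinnertonDyer.BirchSwinnertonDyer.Theorems.BiquadraticEisensteinDescentManinDatumSupercuspidalCMInertTorsionCoreOfResolventBound

end
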